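import Literature.NumberTheory.DiophantineGeometry.CatalanPlusRunge
import Literature.NumberTheory.DiophantineGeometry.CatalanTheoremIV
import Literature.NumberTheory.DiophantineGeometry.CatalanTheoremIIIAll
import HarnessLib

/-!
# The plus argument I, final form: the annihilator of `(x - ζ_p)^{1+ι}` is trivial [Schoof2009, Lemma 12.3, Theorem 12.4]

[Schoof2009, Theorem 12.4]: for distinct primes `p, q ≥ 7` and a non-zero solution of
`x^p - y^q = 1`, the `𝔽_q[G⁺]`-annihilator of `(x - ζ_p)^{1+ι}` in the obstruction group
`H = {α : ord_𝔯(α) ≡ 0 (q), 𝔯 ≠ 𝔭}/K^{*q}` is trivial. Unwinding the group-ring language as in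
[Schoof2009, Lemma 12.3]: an element `ψ ∈ 𝔽_q[G⁺]` annihilating `(x - ζ_p)^{1+ι}` lifts uniquely to
`θ' = ∑_c n_c σ_c ∈ ℤ[G]` with `0 ≤ n_c < q`, `n_{-c} = n_c`, and `(x - ζ_p)^{θ'} = α^q` in `K^*`;
the theorem says that then all `n_c = 0`. This is `Catalan.Plus.eq_zero_of_prod_pow_eq_pow` below,
deduced from the Runge statement `Catalan.Plus.dvd_of_prod_pow_eq_pow` (`CatalanPlusRunge`) by
[Schoof2009, Lemma 12.3]: `∑ n_c = mq` (the `𝔭`-adic valuation; here via ideal norms), and either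
`2m ≤ p - 1` or one passes to `θ'' = ∑ (q - n_c) σ_c`.

* `Catalan.Plus.dvd_sum_of_prod_pow_eq_pow` — `q ∣ ∑ n_c` ([Schoof2009, Lemma 12.3]);
* `Catalan.Plus.eq_zero_of_prod_pow_eq_pow` — **[Schoof2009, Theorem 12.4]**: `n_c < q` for all `c`
  forces `n = 0` (for `p` odd, `q ≥ 7` prime, `p ≠ q`).

and then performs the assembly of **Theorem II** on [Schoof2009, p. 94] (*by symmetry `p > q`;
suppose `p ≢ 1 (mod q)`; by Theorem IV one may assume `p, q ≥ 7`; then [Schoof2009, Theorem 14.1]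
(Thaine's theorem and the semisimple group-ring algebra of Chapter 13) produces a non-zero
`ψ ∈ 𝔽_q[G⁺]` annihilating `S⁺ ∋ (x - ζ_p)^{1+ι}` ([Schoof2009, Cor. 10.3]), contradicting
Theorem 12.4*), with the one input that is not in the tree — Theorem 14.1, i.e. Thaine's theorem —
as an explicit hypothesis in unwound, module-free form (Theorem IV for `3` and `5` is
`Catalan.PiAdic.seven_le`, Theorems I, III and the classical cases are in the tree):

* `hA` — **[Schoof2009, Theorem 14.1 with Corollary 10.3]**: for primes `p > q ≥ 7` with
  `p ≢ 1 (mod q)` and a non-zero solution there is a *non-zero* `θ = ∑ n_c σ_c` (`0 ≤ n_c < q`,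
  `n_{-c} = n_c`: the canonical lift of a non-zero `(1+ι)ψ`, `ψ ∈ 𝔽_q[G⁺]`; the map
  `ψ ↦ (1+ι)ψ` is injective as `q` is odd) with `(x - ζ_p)^θ = ∏_c (x - ζ_p^c)^{n_c} ∈ K^{*q}` —
  this is where Thaine's theorem (class field theory) enters;

giving `Catalan.Plus.theoremII_of_plus` (Theorem II from `hA`, Theorem 12.4 and Theorem IV for
`3, 5` from the tree) and `Catalan.Plus.mihailescu_of_plus` (**Catalan's conjecture from `hA`
alone**, via `Catalan.mihailescu_of_theoremII`).

Everything is proved; no definitions, no new named facts.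

## References

* R. Schoof, *Catalan's Conjecture*, Universitext, Springer 2009 [Schoof2009], Lemma 12.3,
  Theorem 12.4 (book pp. 79–82), Chapter 14 (Theorem 14.1 and the proof of Theorem II,
  pp. 92–94), Theorem IV (p. 4) — held, `lit read book:schoof2009-catalan-s-conjecture`
  (PDF pp. 159–162, 170–172).
* P. Mihăilescu, *Primary cyclotomic units and a proof of Catalan's conjecture*, J. reine angew.
  Math. **572** (2004), 167–195 [Mihailescu2004].
-/

namespace Literature.NumberTheory.DiophantineGeometry

namespace Catalan.Plus

open Finset NumberField

section Cyclotomic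

variable {p : ℕ} [hp : Fact p.Prime] {K : Type*} [Field K] [NumberField K]
  [hK : IsCyclotomicExtension {p} ℚ K] {ζ : K}

/-- **[Schoof2009, Lemma 12.3] (`∑ n_σ ≡ 0 mod q`)**: if `∏_c (x - ζ^c)^{n_c} = α^q` for a
non-zero solution of Catalan's equation, then `q ∣ ∑_c n_c`. Schoof: `π = 1 - ζ_p` divides every
`x - σ(ζ_p)` exactly once, so `∑ n_σ = ord_π(α^q)`. Here: `(x - ζ^c) = 𝔭 𝔞_c^q`
(`Catalan.span_sub_zeta_pow_eq`), so `(α)^q = 𝔭^{∑ n_c} (∏ 𝔞_c^{n_c})^q`; taking ideal norms,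
`N(α)^q = p^{∑ n_c} u^q` in `ℕ`, and `ord_p` gives the claim. [cite: Schoof2009, Lemma 12.3] -/
theorem dvd_sum_of_prod_pow_eq_pow (hζ : IsPrimitiveRoot ζ p) (hpo : Odd p) {q : ℕ} (hq : q.Prime)
    (hqo : Odd q) {x y : ℤ} (hx : x ≠ 0) (hy : y ≠ 0) (h : x ^ p - y ^ q = 1)
    (n : (ZMod p)ˣ → ℕ) {α : K}
    (hα : ∏ c : (ZMod p)ˣ, ((x : K) - ζ ^ (c : ZMod p).val) ^ n c = α ^ q) : q ∣ ∑ c, n c := by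
  classical
  have hp2 : p ≠ 2 := fun h2 => by
    rw [h2] at hpo
    exact (Nat.not_even_iff_odd.mpr hpo) even_two
  set z : 𝓞 K := hζ.toInteger with hzdef
  have hzK : (z : K) = ζ := rfl
  -- `α` is an algebraic integer with `αO^q = ∏ (x - z^c)^{n_c}` in `𝓞 K`
  have hαint : IsIntegral ℤ α := by
    refine IsIntegral.of_pow hq.pos ?_
    rw [← hα]
    have hxint : IsIntegral ℤ (x : K) := by
      have := isIntegral_algebraMap (R := ℤ) (A := K) (x := x)
      rwa [eq_intCast] at this
    exact IsIntegral.prod _ fun c _ =>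
      (hxint.sub ((hζ.isIntegral hp.out.pos).pow _)).pow _
  set αO : 𝓞 K := ⟨α, hαint⟩ with hαOdef
  have hαOq : αO ^ q = ∏ c : (ZMod p)ˣ, ((x : 𝓞 K) - z ^ (c : ZMod p).val) ^ n c := by
    apply FaithfulSMul.algebraMap_injective (𝓞 K) K
    rw [map_pow, map_prod]
    simp only [map_pow, map_sub, map_intCast]
    change α ^ q = ∏ c : (ZMod p)ˣ, ((x : K) - ζ ^ (c : ZMod p).val) ^ n c
    exact hα.symm
  have hA0 : ∏ c : (ZMod p)ˣ, ((x : 𝓞 K) - z ^ (c : ZMod p).val) ^ n c ≠ 0 := by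
    rw [← hαOq]
    refine pow_ne_zero _ fun h0 => ?_
    have h1 : α = 0 := by
      have := congrArg (algebraMap (𝓞 K) K) h0
      rwa [map_zero] at this
    have h2 : ∏ c : (ZMod p)ˣ, ((x : K) - ζ ^ (c : ZMod p).val) ^ n c ≠ 0 :=
      prod_ne_zero_iff.mpr fun c _ => pow_ne_zero _ (Minus.intCast_sub_zeta_pow_ne_zero hζ hp2 x c)
    rw [hα, h1, zero_pow hq.ne_zero] at h2
    exact h2 rfl
  -- the ideal equation `(α)^q = 𝔭^{∑ n_c} · J^q`
  obtain ⟨𝔞, h𝔞⟩ := span_sub_zeta_pow_eq hζ hq hpo hqo hx hy h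
  set P : Ideal (𝓞 K) := Ideal.span {z - 1} with hPdef
  have hc : ∀ c : (ZMod p)ˣ, Ideal.span {(x : 𝓞 K) - z ^ (c : ZMod p).val} =
      P * 𝔞 (c : ZMod p).val ^ q := by
    intro c
    refine (h𝔞 _ (mem_Ico.mpr ⟨?_, ZMod.val_lt _⟩)).1
    rw [Nat.one_le_iff_ne_zero, Ne, ZMod.val_eq_zero]
    exact c.ne_zero
  set J : Ideal (𝓞 K) := ∏ c : (ZMod p)ˣ, 𝔞 (c : ZMod p).val ^ n c with hJdef
  have hideal : Ideal.span {αO} ^ q = P ^ (∑ c, n c) * J ^ q := by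
    rw [Ideal.span_singleton_pow, hαOq, ← Ideal.prod_span_singleton]
    simp_rw [← Ideal.span_singleton_pow, hc, mul_pow, prod_mul_distrib, prod_pow_eq_pow_sum,
      hJdef, ← prod_pow, ← pow_mul, mul_comm q]
  -- ideal norms: `N(α)^q = p^{∑ n_c} · N(J)^q` in `ℕ`
  have hnormP : Ideal.absNorm P = p := by
    rw [hPdef, Ideal.absNorm_span_singleton, hζ.norm_toInteger_sub_one_of_prime_ne_two' hp2,
      Int.natAbs_natCast]
  have hnorm : Ideal.absNorm (Ideal.span {αO}) ^ q = p ^ (∑ c, n c) * Ideal.absNorm J ^ q := by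
    rw [← map_pow, hideal, map_mul, map_pow, map_pow, hnormP]
  have ha0 : Ideal.absNorm (Ideal.span {αO}) ≠ 0 := by
    rw [Ne, Ideal.absNorm_eq_zero_iff, Ideal.span_singleton_eq_bot]
    intro h0
    rw [h0, zero_pow hq.ne_zero] at hαOq
    exact hA0 hαOq.symm
  have hJ0 : Ideal.absNorm J ≠ 0 := by
    intro h0
    rw [h0, zero_pow hq.ne_zero, mul_zero] at hnorm
    exact pow_ne_zero _ ha0 hnorm
  -- `ord_p`
  have hv := congrArg (padicValNat p) hnorm
  rw [padicValNat.pow, padicValNat.mul (pow_ne_zero _ hp.out.ne_zero) (pow_ne_zero _ hJ0),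
    padicValNat.prime_pow, padicValNat.pow] at hv
  set A := q * padicValNat p (Ideal.absNorm (Ideal.span {αO})) with hA
  set B := q * padicValNat p (Ideal.absNorm J) with hB
  have h1 : ∑ c, n c = A - B := by omega
  rw [h1, hA, hB]
  exact Nat.dvd_sub (dvd_mul_right _ _) (dvd_mul_right _ _)

/-- **[Schoof2009, Theorem 12.4]** (the `𝔽_q[G⁺]`-annihilator of `(x - ζ_p)^{1+ι}` in `H` is
trivial; final form via [Schoof2009, Lemma 12.3]). Let `p` be an odd prime, `q ≥ 7` a prime
different from `p`, `x, y` non-zero integers with `x ^ p - y ^ q = 1`, and `n : (ℤ/pℤ)ˣ → ℕ` with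
`n_{-c} = n_c` and `n_c < q` for all `c` (the canonical lift of an element `(1+ι)ψ`, `ψ ∈ 𝔽_q[G⁺]`).
If `∏_c (x - ζ^c)^{n_c} = α^q` for some `α ∈ ℚ(ζ_p)` then `n = 0`.
[cite: Schoof2009, Theorem 12.4] [cite: Schoof2009, Lemma 12.3] -/
theorem eq_zero_of_prod_pow_eq_pow (hζ : IsPrimitiveRoot ζ p) (hpo : Odd p) {q : ℕ} (hq : q.Prime)
    (hq7 : 7 ≤ q) (hpq : p ≠ q) {x y : ℤ} (hx : x ≠ 0) (hy : y ≠ 0) (h : x ^ p - y ^ q = 1)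
    (n : (ZMod p)ˣ → ℕ) (hn : ∀ c, n (-c) = n c) (hnq : ∀ c, n c < q) {α : K}
    (hα : ∏ c : (ZMod p)ˣ, ((x : K) - ζ ^ (c : ZMod p).val) ^ n c = α ^ q) (c₀ : (ZMod p)ˣ) :
    n c₀ = 0 := by
  classical
  have hp2 : p ≠ 2 := fun h2 => by
    rw [h2] at hpo
    exact (Nat.not_even_iff_odd.mpr hpo) even_two
  have hq2 : q ≠ 2 := by omega
  have hqo : Odd q := hq.odd_of_ne_two hq2
  haveI : NeZero p := ⟨hp.out.ne_zero⟩
  -- `∑ n_c = m q`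
  obtain ⟨m, hm⟩ := dvd_sum_of_prod_pow_eq_pow hζ hpo hq hqo hx hy h n hα
  have hcard : Fintype.card (ZMod p)ˣ = p - 1 := by
    rw [ZMod.card_units_eq_totient, Nat.totient_prime hp.out]
  by_cases hmp : 2 * m ≤ p - 1
  · -- apply the Runge statement to `θ' = ∑ n_c σ_c`
    have h1 := dvd_of_prod_pow_eq_pow hζ hpo hq hq7 hpq hx hy h n hn (m := m)
      (by rw [hm, mul_comm]) hmp hα c₀
    exact Nat.eq_zero_of_dvd_of_lt h1 (hnq c₀)
  · -- apply it to `θ'' = ∑ (q - n_c) σ_c`, `(x - ζ_p)^{θ''} = ((∏ (x - ζ^c))/α)^q`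
    have hmp : p - 1 < 2 * m := not_le.mp hmp
    have hA0 : ∀ c : (ZMod p)ˣ, (x : K) - ζ ^ (c : ZMod p).val ≠ 0 := fun c =>
      Minus.intCast_sub_zeta_pow_ne_zero hζ hp2 x c
    have hα0 : α ≠ 0 := by
      rintro rfl
      rw [zero_pow hq.ne_zero] at hα
      exact prod_ne_zero_iff.mpr (fun c _ => pow_ne_zero _ (hA0 c)) hα
    -- the sum of the `q - n_c`
    have hsum : ∑ c, (q - n c) = (p - 1 - m) * q := by
      have h1 : ∑ c, (q - n c) + ∑ c, n c = ∑ c : (ZMod p)ˣ, q := by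
        rw [← sum_add_distrib]
        exact sum_congr rfl fun c _ => Nat.sub_add_cancel (hnq c).le
      rw [sum_const, card_univ, hcard, smul_eq_mul, hm] at h1
      have h2 : m ≤ p - 1 := by
        by_contra h3
        have h3 : p - 1 < m := not_le.mp h3
        have : (p - 1) * q < q * m := by
          rw [mul_comm]; exact Nat.mul_lt_mul_of_pos_left h3 hq.pos
        omega
      have h4 : (p - 1 - m) * q = (p - 1) * q - q * m := by
        rw [Nat.sub_mul, mul_comm m]
      omega
    have hmp' : 2 * (p - 1 - m) ≤ p - 1 := by omega
    have hα' : ∏ c : (ZMod p)ˣ, ((x : K) - ζ ^ (c : ZMod p).val) ^ (q - n c) =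
        ((∏ c : (ZMod p)ˣ, ((x : K) - ζ ^ (c : ZMod p).val)) / α) ^ q := by
      rw [div_pow, ← hα, ← prod_pow, ← prod_div_distrib]
      refine prod_congr rfl fun c _ => ?_
      rw [eq_div_iff (pow_ne_zero _ (hA0 c)), ← pow_add, Nat.sub_add_cancel (hnq c).le]
    have h1 := dvd_of_prod_pow_eq_pow hζ hpo hq hq7 hpq hx hy h (fun c => q - n c)
      (fun c => by simp only [hn]) (m := p - 1 - m) hsum hmp' hα' c₀
    -- `q ∣ q - n_{c₀}` with `0 < q - n_{c₀} ≤ q` forces `n_{c₀} = 0`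
    have h2 : 0 < q - n c₀ := Nat.sub_pos_of_lt (hnq c₀)
    have h3 := Nat.le_of_dvd h2 h1
    omega

end Cyclotomic

/-! ### Theorem II and Catalan's conjecture from Theorem 14.1 -/

/-- **Theorem II from [Schoof2009, Theorem 14.1 (+ Cor. 10.3)].** See the module docstring for the
meaning of the hypothesis `hA` (the non-zero plus annihilator, unwound). The proof is
[Schoof2009, p. 94]: symmetry `(x, y, p, q) ↦ (-y, -x, q, p)`, Lemma 6.1 (`p ≠ q`), Theorem IV
(`p, q ≥ 7`, `Catalan.PiAdic.seven_le`), and for `p > q ≥ 7` the contradiction between `hA` and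
[Schoof2009, Theorem 12.4] (`Catalan.Plus.eq_zero_of_prod_pow_eq_pow`).
[cite: Schoof2009, Theorem II (proof, p. 94)] -/
theorem theoremII_of_plus
    (hA : ∀ (p q : ℕ) [Fact p.Prime], q.Prime → 7 ≤ q → q < p → ¬ p ≡ 1 [MOD q] →
      ∀ (x y : ℤ), x ≠ 0 → y ≠ 0 → x ^ p - y ^ q = 1 →
      ∀ (K : Type) [Field K] [NumberField K] [IsCyclotomicExtension {p} ℚ K] (ζ : K),
        IsPrimitiveRoot ζ p →
        ∃ n : (ZMod p)ˣ → ℕ, (∀ c, n (-c) = n c) ∧ (∀ c, n c < q) ∧ (∃ c, n c ≠ 0) ∧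
          ∃ α : K, ∏ c : (ZMod p)ˣ, ((x : K) - ζ ^ (c : ZMod p).val) ^ n c = α ^ q)
    {p q : ℕ} {x y : ℤ} (hp : p.Prime) (hq : q.Prime) (hpo : Odd p) (hqo : Odd q) (hx : x ≠ 0)
    (hy : y ≠ 0) (h : x ^ p - y ^ q = 1) : p ≡ 1 [MOD q] ∨ q ≡ 1 [MOD p] := by
  -- ### the claim for `q < p`
  suffices key : ∀ {p q : ℕ} {x y : ℤ}, p.Prime → q.Prime → Odd p → Odd q → x ≠ 0 → y ≠ 0 →
      x ^ p - y ^ q = 1 → q < p → p ≡ 1 [MOD q] by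
    rcases lt_trichotomy q p with hlt | rfl | hgt
    · exact Or.inl (key hp hq hpo hqo hx hy h hlt)
    · -- `p = q` is impossible [Schoof2009, Lemma 6.1]
      have hp3 : 3 ≤ q := by
        have := hq.two_le
        rcases hqo with ⟨k, hk⟩
        omega
      exact absurd h (pow_sub_pow_ne_one hqo hp3 hx hy)
    · -- symmetry `(x, y, p, q) ↦ (-y, -x, q, p)`
      have h' : (-y) ^ q - (-x) ^ p = 1 := by
        rw [hqo.neg_pow, hpo.neg_pow]
        linear_combination h
      exact Or.inr (key hq hp hqo hpo (neg_ne_zero.mpr hy) (neg_ne_zero.mpr hx) h' hgt)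
  intro p q x y hp hq hpo hqo hx hy h hqp
  by_contra hmod
  -- Theorem IV [Schoof2009, Chapter 8]: `p, q ≥ 7`
  obtain ⟨-, hq7⟩ := PiAdic.seven_le hp hq hpo hqo hx hy h
  -- `p > q ≥ 7`: the plus annihilator against [Schoof2009, Theorem 12.4]
  haveI := Fact.mk hp
  haveI : NeZero p := ⟨hp.ne_zero⟩
  haveI : IsCyclotomicExtension {p} ℚ (CyclotomicField p ℚ) :=
    CyclotomicField.instIsCyclotomicExtensionSingletonNatSetOfCharZero p ℚ
  haveI : NumberField (CyclotomicField p ℚ) := IsCyclotomicExtension.numberField {p} ℚ _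
  have hζ := IsCyclotomicExtension.zeta_spec p ℚ (CyclotomicField p ℚ)
  obtain ⟨n, hn, hnq, ⟨c, hc⟩, α, hα⟩ :=
    hA p q hq hq7 hqp hmod x y hx hy h (CyclotomicField p ℚ) _ hζ
  exact hc (eq_zero_of_prod_pow_eq_pow hζ hpo hq hq7 (by omega) hx hy h n hn hnq hα c)

/-- **Catalan's conjecture from [Schoof2009, Theorem 14.1 (+ Cor. 10.3)] alone**: with Theorems I,
III, IV (for `3, 5`), the classical cases and Theorem 12.4 in the tree, the non-vanishing of the
`𝔽_q[G⁺]`-annihilator of `S⁺` (Thaine's theorem) is the one remaining input of Mihăilescu's proof.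
[cite: Schoof2009, Chapter 1 (proof of Catalan's conjecture from Theorems I–IV)]
[cite: Mihailescu2004, Theorem 1] -/
theorem mihailescu_of_plus
    (hA : ∀ (p q : ℕ) [Fact p.Prime], q.Prime → 7 ≤ q → q < p → ¬ p ≡ 1 [MOD q] →
      ∀ (x y : ℤ), x ≠ 0 → y ≠ 0 → x ^ p - y ^ q = 1 →
      ∀ (K : Type) [Field K] [NumberField K] [IsCyclotomicExtension {p} ℚ K] (ζ : K),
        IsPrimitiveRoot ζ p →
        ∃ n : (ZMod p)ˣ → ℕ, (∀ c, n (-c) = n c) ∧ (∀ c, n c < q) ∧ (∃ c, n c ≠ 0) ∧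
          ∃ α : K, ∏ c : (ZMod p)ˣ, ((x : K) - ζ ^ (c : ZMod p).val) ^ n c = α ^ q) :
    mihailescu :=
  mihailescu_of_theoremII fun hp hq hpo hqo hx hy h => theoremII_of_plus hA hp hq hpo hqo hx hy h


end Catalan.Plus

end Literature.NumberTheory.DiophantineGeometry
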